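import Literature.MathematicalPhysics.QuantumLattice.HubbardScaleData

/-!
# Loosening a slack scale datum (stub `stub_loosenedDatum`, S7 of line `seed-strength-flow`,
# crux `SeededBrokenRegimeBoseFermiPinned` = stmt-HubbardSuperconductivity-14047)

Pure `ℚ`-bookkeeping on the certificate record `HubbardScaleData` (route AposterioriCapRg): a datum that meets
the ANCHOR thresholds with slack — gap ratio `20`, stiffness threshold `2·kStar`, remainder threshold
`etaStar/2`, `0 < m₀.fst` — is loosened, keeping its scale, patch number and nodal set (hence its CT report),
to a datum meeting `MeetsThresholds kStar etaStar` whose intervals contain those of `D` and contain the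
factor-two box of the line's STEP stub (`ρ_s ∈ [⅔ρ.fst, 2ρ.snd]`, `κ, m₀` within factor `2`, velocities in
`[v.fst/2, 4v.snd/3]`, gaps widened by `10Λ₀`, `0 ≤ η ≤ 2η.snd`).  Budget: `kΛ₀·(4/3)v.snd ≤ ⅔ρ.fst`,
`(kΛ₀)² ≤ ρκ/4 ≤ (⅔ρ.fst)(κ.fst/2)`, `20Λ₀ − 10Λ₀ = 10Λ₀`, `2·(etaStar/2) = etaStar`.
No model content; source: folklore interval arithmetic on the a-posteriori record (format
Figueras–Haro–Luque 2016, Thm. 2.5).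
-/

set_option linter.dupNamespace false -- `Summit.<S>.<S>` doubles the summit name (tree convention)

namespace Summit.HubbardSuperconductivity.HubbardSuperconductivity.Theorems.AposterioriCapRgSeededBrokenRegimeBoseFermiPinned

open Literature.MathematicalPhysics.QuantumLattice NonemptyInterval

/-- Membership in the real cast of a rational interval from the two end-point inequalities. [folklore] -/
theorem mem_ratCast_of_le_of_le {I : NonemptyInterval ℚ} {x : ℝ} (h₁ : ((I.fst : ℚ) : ℝ) ≤ x)
    (h₂ : x ≤ ((I.snd : ℚ) : ℝ)) : x ∈ I.ratCast ℝ :=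
  NonemptyInterval.mem_ratCast_iff.2 ⟨h₁, h₂⟩

/-- **S7 (`LoosenedDatum`)** of line `seed-strength-flow`: a datum meeting the anchor thresholds with slack can be
LOOSENED — same scale, patch number and nodal set; gaps widened by `10Λ₀`; `ρ_s ↦ [⅔ρ.fst, 2ρ.snd]`,
`κ ↦ [κ.fst/2, 2κ.snd]`, `v ↦ [v.fst/2, 4v.snd/3]`, `η ↦ [min(η.fst,0), max(2η.snd, η.snd)]`,
`m₀ ↦ [m₀.fst/2, 2m₀.snd]` — to a datum meeting `MeetsThresholds kStar etaStar` with `0 < m₀'.fst`, enclosing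
everything `D` encloses, and enclosing every tuple of the factor-two box with `η ≥ 0`. [folklore] -/
theorem stub_loosenedDatum :
    ∀ (D : HubbardScaleData) (kStar etaStar : ℚ), 0 < kStar → 0 < etaStar →
      D.MeetsThresholdsWith 20 (2 * kStar) (etaStar / 2) → 0 < D.meanFieldDensity.fst →
        ∃ (gap' : Fin D.numPatches → NonemptyInterval ℚ) (ρ' κ' vF' vΔ' η' m₀' : NonemptyInterval ℚ),
          (HubbardScaleData.mk D.scale D.scale_pos D.numPatches D.nodal gap' ρ' κ' vF' vΔ' η' m₀').MeetsThresholds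
              kStar etaStar ∧
          0 < m₀'.fst ∧
          (∀ p : HubbardScaleData.Parameters D.numPatches, D.Encloses p →
            (HubbardScaleData.mk D.scale D.scale_pos D.numPatches D.nodal gap' ρ' κ' vF' vΔ' η' m₀').Encloses p) ∧
          (∀ p : HubbardScaleData.Parameters D.numPatches, 0 ≤ p.remainderNorm →
            ((∀ i, ((D.gap i).fst : ℝ) - 10 * (D.scale : ℝ) ≤ p.gap i ∧ p.gap i ≤ ((D.gap i).snd : ℝ) + 10 * (D.scale : ℝ)) ∧
                  2 / 3 * (D.stiffness.fst : ℝ) ≤ p.stiffness ∧ p.stiffness ≤ 2 * (D.stiffness.snd : ℝ) ∧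
                  (D.compressibility.fst : ℝ) / 2 ≤ p.compressibility ∧
                  p.compressibility ≤ 2 * (D.compressibility.snd : ℝ) ∧
                  (D.fermiVelocity.fst : ℝ) / 2 ≤ p.fermiVelocity ∧ p.fermiVelocity ≤ 4 / 3 * (D.fermiVelocity.snd : ℝ) ∧
                  (D.gapVelocity.fst : ℝ) / 2 ≤ p.gapVelocity ∧ p.gapVelocity ≤ 4 / 3 * (D.gapVelocity.snd : ℝ) ∧
                  p.remainderNorm ≤ 2 * (D.remainderNorm.snd : ℝ) ∧
                  (D.meanFieldDensity.fst : ℝ) / 2 ≤ p.meanFieldDensity ∧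
                  p.meanFieldDensity ≤ 2 * (D.meanFieldDensity.snd : ℝ)) →
              (HubbardScaleData.mk D.scale D.scale_pos D.numPatches D.nodal gap' ρ' κ' vF' vΔ' η' m₀').Encloses p) := by
  intro D kStar etaStar hk he hD hm
  obtain ⟨hκ, hvF, hvΔ, h1, h2, h3, h4, h5⟩ := hD
  have hΛ : 0 < D.scale := D.scale_pos
  have hvFs : 0 < D.fermiVelocity.snd := hvF.trans_le D.fermiVelocity.fst_le_snd
  have hvΔs : 0 < D.gapVelocity.snd := hvΔ.trans_le D.gapVelocity.fst_le_snd
  have hκs : 0 < D.compressibility.snd := hκ.trans_le D.compressibility.fst_le_snd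
  have hms : 0 < D.meanFieldDensity.snd := hm.trans_le D.meanFieldDensity.fst_le_snd
  have hρ : 0 < D.stiffness.fst := by
    have : 0 < 2 * kStar * D.scale * D.fermiVelocity.snd := by positivity
    exact this.trans_le h1
  have hρs : 0 < D.stiffness.snd := hρ.trans_le D.stiffness.fst_le_snd
  -- the loosened intervals
  refine ⟨fun i => ⟨((D.gap i).fst - 10 * D.scale, (D.gap i).snd + 10 * D.scale), by
      show (D.gap i).fst - 10 * D.scale ≤ (D.gap i).snd + 10 * D.scale
      linarith [(D.gap i).fst_le_snd]⟩,
    ⟨(2 / 3 * D.stiffness.fst, 2 * D.stiffness.snd), by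
      show 2 / 3 * D.stiffness.fst ≤ 2 * D.stiffness.snd
      linarith [D.stiffness.fst_le_snd]⟩,
    ⟨(D.compressibility.fst / 2, 2 * D.compressibility.snd), by
      show D.compressibility.fst / 2 ≤ 2 * D.compressibility.snd
      linarith [D.compressibility.fst_le_snd]⟩,
    ⟨(D.fermiVelocity.fst / 2, 4 / 3 * D.fermiVelocity.snd), by
      show D.fermiVelocity.fst / 2 ≤ 4 / 3 * D.fermiVelocity.snd
      linarith [D.fermiVelocity.fst_le_snd]⟩,
    ⟨(D.gapVelocity.fst / 2, 4 / 3 * D.gapVelocity.snd), by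
      show D.gapVelocity.fst / 2 ≤ 4 / 3 * D.gapVelocity.snd
      linarith [D.gapVelocity.fst_le_snd]⟩,
    ⟨(min D.remainderNorm.fst 0, max (2 * D.remainderNorm.snd) D.remainderNorm.snd), by
      show min D.remainderNorm.fst 0 ≤ max (2 * D.remainderNorm.snd) D.remainderNorm.snd
      exact (min_le_left _ _).trans (D.remainderNorm.fst_le_snd.trans (le_max_right _ _))⟩,
    ⟨(D.meanFieldDensity.fst / 2, 2 * D.meanFieldDensity.snd), by
      show D.meanFieldDensity.fst / 2 ≤ 2 * D.meanFieldDensity.snd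
      linarith [D.meanFieldDensity.fst_le_snd]⟩,
    ?_, ?_, ?_, ?_⟩
  · -- thresholds of the loosened datum
    show HubbardScaleData.MeetsThresholdsWith _ 10 kStar etaStar
    refine ⟨?_, ?_, ?_, ?_, ?_, ?_, ?_, ?_⟩
    · show 0 < D.compressibility.fst / 2
      positivity
    · show 0 < D.fermiVelocity.fst / 2
      positivity
    · show 0 < D.gapVelocity.fst / 2
      positivity
    · show kStar * D.scale * (4 / 3 * D.fermiVelocity.snd) ≤ 2 / 3 * D.stiffness.fst
      nlinarith
    · show kStar * D.scale * (4 / 3 * D.gapVelocity.snd) ≤ 2 / 3 * D.stiffness.fst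
      nlinarith
    · show (kStar * D.scale) ^ 2 ≤ 2 / 3 * D.stiffness.fst * (D.compressibility.fst / 2)
      nlinarith [mul_pos hρ hκ]
    · intro i hi
      show 10 * D.scale ≤ (D.gap i).fst - 10 * D.scale ∨ (D.gap i).snd + 10 * D.scale ≤ -(10 * D.scale)
      rcases h4 i hi with h | h
      · left; linarith
      · right; linarith
    · show max (2 * D.remainderNorm.snd) D.remainderNorm.snd ≤ etaStar
      exact max_le (by linarith) (by linarith)
  · show 0 < D.meanFieldDensity.fst / 2
    positivity
  · -- everything `D` encloses is enclosed
    intro p hp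
    obtain ⟨hg, hρ', hκ', hvF', hvΔ', hη', hm'⟩ := hp
    simp only [NonemptyInterval.mem_ratCast_iff] at hg hρ' hκ' hvF' hvΔ' hη' hm'
    have cρ : (0 : ℝ) < D.stiffness.fst := by exact_mod_cast hρ
    have cρs : (0 : ℝ) < D.stiffness.snd := by exact_mod_cast hρs
    have cκ : (0 : ℝ) < D.compressibility.fst := by exact_mod_cast hκ
    have cκs : (0 : ℝ) < D.compressibility.snd := by exact_mod_cast hκs
    have cvF : (0 : ℝ) < D.fermiVelocity.fst := by exact_mod_cast hvF
    have cvFs : (0 : ℝ) < D.fermiVelocity.snd := by exact_mod_cast hvFs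
    have cvΔ : (0 : ℝ) < D.gapVelocity.fst := by exact_mod_cast hvΔ
    have cvΔs : (0 : ℝ) < D.gapVelocity.snd := by exact_mod_cast hvΔs
    have cm : (0 : ℝ) < D.meanFieldDensity.fst := by exact_mod_cast hm
    have cms : (0 : ℝ) < D.meanFieldDensity.snd := by exact_mod_cast hms
    have cΛ : (0 : ℝ) < D.scale := by exact_mod_cast hΛ
    refine ⟨fun i => mem_ratCast_of_le_of_le ?_ ?_, mem_ratCast_of_le_of_le ?_ ?_, mem_ratCast_of_le_of_le ?_ ?_,
      mem_ratCast_of_le_of_le ?_ ?_, mem_ratCast_of_le_of_le ?_ ?_, mem_ratCast_of_le_of_le ?_ ?_,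
      mem_ratCast_of_le_of_le ?_ ?_⟩
    · push_cast; linarith [(hg i).1]
    · push_cast; linarith [(hg i).2]
    · push_cast; linarith [hρ'.1]
    · push_cast; linarith [hρ'.2]
    · push_cast; linarith [hκ'.1]
    · push_cast; linarith [hκ'.2]
    · push_cast; linarith [hvF'.1]
    · push_cast; linarith [hvF'.2]
    · push_cast; linarith [hvΔ'.1]
    · push_cast; linarith [hvΔ'.2]
    · push_cast; exact (min_le_left _ _).trans hη'.1
    · push_cast; exact hη'.2.trans (le_max_right _ _)
    · push_cast; linarith [hm'.1]
    · push_cast; linarith [hm'.2]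
  · -- the factor-two box is enclosed
    intro p hη0 hbox
    obtain ⟨hg, hρ1, hρ2, hκ1, hκ2, hvF1, hvF2, hvΔ1, hvΔ2, hη2, hm1, hm2⟩ := hbox
    refine ⟨fun i => mem_ratCast_of_le_of_le ?_ ?_, mem_ratCast_of_le_of_le ?_ ?_, mem_ratCast_of_le_of_le ?_ ?_,
      mem_ratCast_of_le_of_le ?_ ?_, mem_ratCast_of_le_of_le ?_ ?_, mem_ratCast_of_le_of_le ?_ ?_,
      mem_ratCast_of_le_of_le ?_ ?_⟩
    · push_cast; exact (hg i).1
    · push_cast; exact (hg i).2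
    · push_cast; exact hρ1
    · push_cast; exact hρ2
    · push_cast; exact hκ1
    · push_cast; exact hκ2
    · push_cast; exact hvF1
    · push_cast; exact hvF2
    · push_cast; exact hvΔ1
    · push_cast; exact hvΔ2
    · push_cast; exact (min_le_right _ _).trans hη0
    · push_cast; exact hη2.trans (le_max_left _ _)
    · push_cast; exact hm1
    · push_cast; exact hm2

end Summit.HubbardSuperconductivity.HubbardSuperconductivity.Theorems.AposterioriCapRgSeededBrokenRegimeBoseFermiPinned
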